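import Literature.NumberTheory.EllipticCurves.TowerLiftableConnectingProofs
import Literature.NumberTheory.EllipticCurves.TowerLiftableOfDualityProofs
import HarnessLib

/-!
# Classes killed by `H¹(×p^d)` are bottom-condition classes: the (Ker) input of the H.4 descent (theorems only)

`Proofs` file (theorems only; no definition, no named fact, no instance, no `sorry`), companion of
`TowerLiftableConnectingProofs` (x9-p1-w3 g5, (L1)) in the SAME currency: a tower of discrete `Γ_F`-modules
`ρ j : DiscreteGaloisModule F (W j)` presented by ONE two-index family `f a b : W a → W b` (reductions for `b ≤ a`,
the injective `Quot(T)`-morphisms `×p^{b-a}` for `a ≤ b`) with the identities `hid/hcomp/hsq/hinj/hsurj/hex/hkill`, and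
the short exact rows `isSES_of_exact ρ f hinj hsurj hex j d : 0 → W j → W (j+d) → W d → 0`.

Howard's H.4 for the saturated local conditions `F_𝔮` is obtained in the tree by DESCENT from the limit
(`TowerSaturatedAnnihilatorProofs`, `TowerTorsionAnnihilatorProofs`); its input (Dual) — «a class orthogonal to the
bottom condition is liftable» (`Tower.mem_levelCondition_top_of_forall_pairing_bot_eq_zero[_of_range]`, x10b-p1-w8 /
x9-p1-w4) — asks for the hypothesis

  (Ker)  `up_d x = 0 → x ∈ levelCondition red p ⊥ k`  for `up_d = H¹(f k (k+d)) : H¹(F, W k) → H¹(F, W (k+d))`,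

i.e. «the kernel of `H¹(×p^d)` consists of components of `p`-power-torsion compatible families».  This file proves it
for every presented tower (cell `pub/bsd-print-x9`, LEAD `bsd-line-x10b-p1` g8, custodian ruling 19:04Z (H4-KER)):

* §1 **`exists_mem_compatibleFamilies_apply_eq_δ₀`** — for an invariant `u` of `W d` and any `d`, the connecting classes
  `x j := δ₀^{(j,d)} u ∈ H¹(F, W j)` of the rows `0 → W j → W (j+d) → W d → 0` form a COMPATIBLE family (naturality of
  `δ₀` along the morphism of rows `(f (j+1) j, f (j+1+d) (j+d), id)` — the mixed square is `apply_up_down_comm`, the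
  right square is `hcomp`), killed by `p^d` (`hkill d`); (L1)'s `exists_mem_compatibleFamilies_apply_one_eq_δ₀` is the
  case `d = 1` read at level `1`.
* §2 **`mem_levelCondition_bot_of_map_up_eq_zero`** — (Ker): a class `x ∈ H¹(F, W k)` with `H¹(f k (k+d)) x = 0` is
  `δ₀^{(k,d)} u` for an invariant `u` of `W d` (exactness of the long exact sequence at `H¹(F, W k)`,
  `IsSES.exists_δ₀_eq_of_map_one_eq_zero`), hence the level-`k` component of a `p^d`-torsion compatible family, hence in
  `levelCondition red p (fun _ ↦ ⊥) k` (`apply_mem_levelCondition_of_nsmul_eq_zero`); and the `AddMonoidHom`-shaped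
  corollary `ker_map_up_le_levelCondition_bot` (verbatim the binder `hKer` of
  `Tower.mem_levelCondition_top_of_forall_pairing_bot_eq_zero_of_range`, with `up d := H¹(f k (k + d))`).

Nothing arithmetic is proved here; no summit statement is proved; BSD is not proved by any of this.

References: B. Howard, Compositio Math. 140 (2004), Def. 1.1.3, §1.3 H.4, Def. 3.2.6 (arXiv:1202.6340 p. 5, p. 7 L69–82,
p. 16); J.-P. Serre, *Galois Cohomology* (1997), I §2.2 (the long exact sequence and naturality of `δ`);
NSW (2008), (1.3.2)–(1.3.3); J. S. Milne, *Arithmetic Duality Theorems* (2006), I Cor. 2.3.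
-/

noncomputable section

open CategoryTheory
open scoped ContRepresentation

universe u

namespace Literature.NumberTheory.EllipticCurves

namespace Tower

open Literature.NumberTheory.GaloisRepresentations

variable {F : Type u} [Field F]
variable {W : ℕ → Type u} [∀ j, AddCommGroup (W j)] [∀ j, TopologicalSpace (W j)]
  [∀ j, DiscreteTopology (W j)]
variable (ρ : ∀ j, DiscreteGaloisModule F (W j))
variable (f : ∀ a b, (ρ a).toContRepresentation →ⁱL (ρ b).toContRepresentation)

/-! ## §1 The connecting classes of an invariant of `W d` form a compatible `p^d`-torsion family -/

/-- **`δ₀`-classes are liftable, every graded piece.**  For an invariant `u` of `W d`, the connecting classes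
`x j := δ₀^{(j,d)} u ∈ H¹(F, W j)` of the short exact rows `0 → W j → W (j+d) → W d → 0` form a COMPATIBLE family of the
`H¹`-tower (naturality of `δ₀` along `(f (j+1) j, f (j+1+d) (j+d), id)`), they are killed by `p^d` (`p^d • u = 0` by
`hkill`), and `x k = δ₀^{(k,d)} u`. [cite: Howard2004HeegnerKolyvagin, Def. 1.1.3 and §1.6 (arXiv p. 5 L95–97, p. 12 L29–55)]
[cite: SerreGaloisCohomology1997, Ch. I §2.2] [cite: NeukirchSchmidtWingberg2008, (1.3.3)] -/
theorem exists_mem_compatibleFamilies_apply_eq_δ₀ (hid : ∀ a (w : W a), f a a w = w)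
    (hcomp : ∀ a b c, c ≤ b → b ≤ a → ∀ w : W a, f b c (f a b w) = f a c w)
    (hsq : ∀ a b, a ≤ b → ∀ w : W (a + 1), f a b (f (a + 1) a w) = f (b + 1) b (f (a + 1) (b + 1) w))
    (hinj : ∀ ℓ n, Function.Injective (f ℓ (ℓ + n)))
    (hsurj : ∀ ℓ n, Function.Surjective (f (ℓ + n) n))
    (hex : ∀ ℓ n (y : W (ℓ + n)), f (ℓ + n) n y = 0 ↔ ∃ x, f ℓ (ℓ + n) x = y)
    (p : ℕ) (hkill : ∀ j (w : W j), p ^ j • w = 0) (k d : ℕ)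
    (u : (ρ d).toTopRep.ρ.invariants) :
    ∃ x ∈ compatibleFamilies (H := fun j ↦ galoisCohomology (ρ j) 1) (fun j ↦ galoisCohomology.map (f (j + 1) j) 1),
      (∀ j, p ^ d • x j = 0) ∧ x k = (isSES_of_exact ρ f hinj hsurj hex k d).δ₀ u := by
  refine ⟨fun j ↦ (isSES_of_exact ρ f hinj hsurj hex j d).δ₀ u, ?_, fun j ↦ ?_, rfl⟩
  · rw [mem_compatibleFamilies_iff]
    intro j
    -- naturality of `δ₀` along the morphism of rows `(f (j+1) j, f (j+1+d) (j+d), id)`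
    have hnat := IsSES.cohomologyMap_δ₀ (h := isSES_of_exact ρ f hinj hsurj hex (j + 1) d)
      (h' := isSES_of_exact ρ f hinj hsurj hex j d)
      (φ₁ := TopRep.ofHom ⟨(f (j + 1) j).toContinuousLinearMap, (f (j + 1) j).isIntertwining'⟩)
      (φ₂ := TopRep.ofHom ⟨(f (j + 1 + d) (j + d)).toContinuousLinearMap, (f (j + 1 + d) (j + d)).isIntertwining'⟩)
      (φ₃ := 𝟙 _) (fun w ↦ apply_up_down_comm ρ f hid hcomp hsq (Nat.le_succ j) d w)
      (fun w ↦ (hcomp (j + 1 + d) (j + d) d (Nat.le_add_left d j) (by omega) w).symm) u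
    have hu : (⟨(𝟙 (ρ d).toTopRep : (ρ d).toTopRep ⟶ (ρ d).toTopRep).hom (u : W d),
        IsSES.mem_invariants_map (g := TopRep.ofHom ⟨(f (j + 1 + d) d).toContinuousLinearMap,
          (f (j + 1 + d) d).isIntertwining'⟩) (φ₂ := TopRep.ofHom ⟨(f (j + 1 + d) (j + d)).toContinuousLinearMap,
          (f (j + 1 + d) (j + d)).isIntertwining'⟩)
          (fun w ↦ (hcomp (j + 1 + d) (j + d) d (Nat.le_add_left d j) (by omega) w).symm) u⟩ :
          (ρ d).toTopRep.ρ.invariants) = u := Subtype.ext rfl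
    rw [hu] at hnat
    rw [galoisCohomology.map_eq_cohomologyMap_apply]
    exact hnat
  · have hpu : p ^ d • u = 0 := Subtype.ext (by
      rw [AddSubmonoidClass.coe_nsmul, ZeroMemClass.coe_zero]
      exact hkill d (u : W d))
    exact (map_nsmul (isSES_of_exact ρ f hinj hsurj hex j d).δ₀ (p ^ d) u).symm.trans
      (by rw [hpu, map_zero]; exact rfl)

/-! ## §2 (Ker): classes killed by `H¹(×p^d)` lie in the bottom level condition -/

/-- **(Ker)**: a class `x ∈ H¹(F, W k)` killed by `H¹(f k (k+d)) : H¹(F, W k) → H¹(F, W (k+d))` is a connecting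
class `δ₀^{(k,d)} u` of an invariant `u` of `W d` (exactness of the long exact sequence of `0 → W k → W (k+d) → W d →
0` at `H¹(F, W k)`), hence the level-`k` component of a `p^d`-torsion compatible family, hence lies in the BOTTOM
saturated level condition `levelCondition red p ⊥ k` (the images of the torsion of the limit).
[cite: Howard2004HeegnerKolyvagin, §1.3 H.4 and Def. 3.2.6 (arXiv p. 7 L78–82, p. 16)] [cite: SerreGaloisCohomology1997, Ch. I §2.2] -/
theorem mem_levelCondition_bot_of_map_up_eq_zero (hid : ∀ a (w : W a), f a a w = w)
    (hcomp : ∀ a b c, c ≤ b → b ≤ a → ∀ w : W a, f b c (f a b w) = f a c w)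
    (hsq : ∀ a b, a ≤ b → ∀ w : W (a + 1), f a b (f (a + 1) a w) = f (b + 1) b (f (a + 1) (b + 1) w))
    (hinj : ∀ ℓ n, Function.Injective (f ℓ (ℓ + n)))
    (hsurj : ∀ ℓ n, Function.Surjective (f (ℓ + n) n))
    (hex : ∀ ℓ n (y : W (ℓ + n)), f (ℓ + n) n y = 0 ↔ ∃ x, f ℓ (ℓ + n) x = y)
    (p : ℕ) (hkill : ∀ j (w : W j), p ^ j • w = 0) (k d : ℕ)
    (x : galoisCohomology (ρ k) 1) (hx : galoisCohomology.map (f k (k + d)) 1 x = 0) :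
    x ∈ levelCondition (H := fun j ↦ galoisCohomology (ρ j) 1) (fun j ↦ galoisCohomology.map (f (j + 1) j) 1) p
      (fun j ↦ (⊥ : AddSubgroup (galoisCohomology (ρ j) 1))) k := by
  -- exactness at `H¹(F, W k)`: `x = δ₀ u`
  have hx' : cohomologyMap (TopRep.ofHom ⟨(f k (k + d)).toContinuousLinearMap, (f k (k + d)).isIntertwining'⟩ :
      (ρ k).toTopRep ⟶ (ρ (k + d)).toTopRep) 1 x = 0 := by
    rw [← galoisCohomology.map_eq_cohomologyMap_apply]; exact hx
  obtain ⟨u, hu⟩ := (isSES_of_exact ρ f hinj hsurj hex k d).exists_δ₀_eq_of_map_one_eq_zero x hx'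
  -- the compatible `p^d`-torsion family of connecting classes through `u`
  obtain ⟨y, hy, hyp, hyk⟩ := exists_mem_compatibleFamilies_apply_eq_δ₀ ρ f hid hcomp hsq hinj hsurj hex p hkill k d u
  have hyL : y k ∈ levelCondition (H := fun j ↦ galoisCohomology (ρ j) 1)
      (fun j ↦ galoisCohomology.map (f (j + 1) j) 1) p (fun j ↦ (⊥ : AddSubgroup (galoisCohomology (ρ j) 1))) k :=
    (mem_levelCondition_iff _ p _ k (y k)).2
      ⟨y, (mem_saturatedFamilies_iff _ p _ y).2 ⟨(mem_compatibleFamilies_iff _ y).1 hy, d, fun j ↦ by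
        rw [hyp j]; exact zero_mem _⟩, rfl⟩
  have hxy : y k = x := by rw [hyk]; exact hu
  exact hxy ▸ hyL

/-- (Ker) in the binder shape of `Tower.mem_levelCondition_top_of_forall_pairing_bot_eq_zero_of_range` (`hKer`, with
`up d := H¹(f k (k + d))` as an additive map): **`ker H¹(×p^d) ≤ levelCondition red p ⊥ k`** for every `d`.
[cite: Howard2004HeegnerKolyvagin, §1.3 H.4 (arXiv p. 7 L78–82)] [cite: MilneADT2006, Ch. I Cor. 2.3] -/
theorem ker_map_up_le_levelCondition_bot (hid : ∀ a (w : W a), f a a w = w)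
    (hcomp : ∀ a b c, c ≤ b → b ≤ a → ∀ w : W a, f b c (f a b w) = f a c w)
    (hsq : ∀ a b, a ≤ b → ∀ w : W (a + 1), f a b (f (a + 1) a w) = f (b + 1) b (f (a + 1) (b + 1) w))
    (hinj : ∀ ℓ n, Function.Injective (f ℓ (ℓ + n)))
    (hsurj : ∀ ℓ n, Function.Surjective (f (ℓ + n) n))
    (hex : ∀ ℓ n (y : W (ℓ + n)), f (ℓ + n) n y = 0 ↔ ∃ x, f ℓ (ℓ + n) x = y)
    (p : ℕ) (hkill : ∀ j (w : W j), p ^ j • w = 0) (k d : ℕ) :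
    (galoisCohomology.map (f k (k + d)) 1).ker ≤
      levelCondition (H := fun j ↦ galoisCohomology (ρ j) 1) (fun j ↦ galoisCohomology.map (f (j + 1) j) 1) p
        (fun j ↦ (⊥ : AddSubgroup (galoisCohomology (ρ j) 1))) k :=
  fun x hx ↦ mem_levelCondition_bot_of_map_up_eq_zero ρ f hid hcomp hsq hinj hsurj hex p hkill k d x
    ((AddMonoidHom.mem_ker).1 hx)

end Tower

end Literature.NumberTheory.EllipticCurves
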